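import Literature.AnabelianGeometry.EtaleTheta.TemperedFrobenioidOfRlfZWeakIsoEquivalence
import Literature.AnabelianGeometry.EtaleTheta.BiKummerThm44HypOfGaloisCoveringZTowerAll
import Literature.AnabelianGeometry.EtaleTheta.LogDivisorModelTateTowerReflection
import HarnessLib

/-!
# [EtTh] Thm. 4.4: `Thm44Hyp` between two DIFFERENT §4 settings with a NON-identity `Ψ` — the ℤ-tower at a character `φ`
# and at `φ⁻¹`, related by the chain reflection `n ↦ −n` (class (b) NV)

S. Mochizuki, *The étale theta function …*, Publ. RIMS **45** (2009) [MochizukiEtTh2009], §1 p.12 (the chain `Z_∞` of copies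
of the projective line, Galois group `ℤ`), Def. 3.3 (iii) p.73, Def. 3.6 (i)(ii) p.76–77, Def. 4.1 p.86, Thm. 4.4 p.93–95
[cite: MochizukiEtTh2009, Thm 4.4 p.93]; [FrdI] Thm. 5.2 (i) p.100, Cor. 5.4 p.104.

abc-iut cell, layer L2 [EtTh], seat abc-iut-w5-d179 (gen 7), L2-lead row R751/R761 «NONID-PSI-3», FILE 2 of 2 (piece 3 of the
non-identity-`Ψ` route; piece 1 = p473513 `LogDivisorModelTateTowerReflection`, piece 2 = p473903 `RealificationIsoWeak`, engine =
`TemperedFrobenioidOfRlfZWeakIsoEquivalence`).  Every `Thm44Hyp` inhabited so far at constructed data (p452830, p464833, p467461) is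
the IDENTITY self-equivalence `Ψ = 𝟭`.  THIS FILE: for every tempered arithmetic group `X`, every pair of characters
`φ, φ' : Π^tp_X → ℤ` with `φ' = φ⁻¹` pointwise (`hφ`; e.g. `φ' := φ⁻¹`, `ZTower.inv_apply_eq`), and every `R, S, NH, NH', M`:
* `ZTowerTempered.reflectIsoData X φ φ' hφ R S` — the isomorphism of Def. 3.3 (iii) data `dm X φ ≅ dm X φ'` along the common base
  functor `B^temp(Π^tp_X)⁰ ⥤ CosetCat Π^tp_X` given by this lineage's chain reflection (`ZTower.reflectPhiZero` on
  `Φ₀ = Hom_Π(Π/H, Div⁺(Z_∞))`, `ZTower.reflectBZero` = `U ↦ U⁻¹` on `B₀`; natural in the covering BY `rfl`; `div₀`-compatible by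
  `divZeroHom_reflectBZero`), packaged as the engine's `TemperedFrobenioid.PfIsoData`;
* **`ZTowerTempered.reflectEquiv X φ φ' hφ R S : (temperedFrobenioid X φ R S).category ≌ (temperedFrobenioid X φ' R S).category`**
  — the induced equivalence of the two ℤ-tower tempered Frobenioids (FILE 1: [FrdI] Cor. 5.4), over `𝟭` on the base, acting on
  divisor classes by the reflection: `(A, [ι ψ]) ↦ (A, [ι (ψ ∘ (n ↦ −n))])` (`reflectEquiv_functor_obj`, `coe_ηHom_toR`:
  `η (ι ψ) = ι (reflect ψ)`, coordinates `(s, n) ↦ (s, −n)` by `ZTower.coord_reflectPhiZero`; on morphisms `Base`, `deg_Fr` are kept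
  and `Div ↦ η Div`, `u ↦ β u` — the engine's `PfIsoData.div_equivalence_functor_map` &c. apply verbatim, `reflectEquiv` unfolding
  to `(reflectIsoData …).equivalence` by `rfl`);
* **`ZTowerTempered.thm44HypReflect X φ φ' hφ R S NH NH' M : Thm44Hyp (setting X φ R S NH M) (setting X φ' R S NH' M)`** with
  `Ψ := reflectEquiv`, `Ψ^bs := 𝟭`, `comm` on the nose, `A_⊙ ↦ A_⊙`; `Φ` non-dilating on both sides by p467461's
  `ZTowerTempered.isNonDilating`, `baseShape` / `H_⊙` open as in p463800 / p464833;
* the Thm. 4.4 closers FIRED BY NAME at this `h` (this lineage's `…_of_baseInj_treeVocabWeak` family ⇐ {`hBD X φ`, `hBD X φ'`}):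
  `thm44_i_reflect`, `preservesFrobeniusStructure_reflect`, `thm44_trivNH_reflect` ((i) ∧ (ii) ∧ (iii) ∧ N-th roots, trivial
  `(N, H)`-slot), `thm44_rootsNH_reflect` (the same at abc-iut-w4-d044's roots reading).
For `φ' ≠ φ` (any `φ ≠ 1`) the two settings are over DIFFERENT Def. 3.3 (iii) data (translation by `φ g` vs. by `−φ g` on the
chain), the two categories are different types, and `Ψ` is not an identity functor — the first such `Thm44Hyp` in the tree.
Class (b): 4 defs (`reflectIsoData`, `reflectEquiv`, `thm44HypReflect`, `ψReflect`) + 2 abbrevs; no Prop fact, no instance, no sorry.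
HONEST FRAMING: combinatorial model of the divisor/Galois skeleton (`TateTower.model`), `φ` a parameter, `Ψ^bs = 𝟭` (the base
categories coincide); interface records as before; nothing here bears on [IUTchIII] Cor. 3.12; typed ≠ proved.
-/

noncomputable section

namespace Literature.AnabelianGeometry.EtaleTheta

open CategoryTheory Opposite Function Literature.AlgebraicGeometry.Frobenioids
  Literature.AnabelianGeometry.SemiGraphs LogDivisorModel LogDivisorModel.GaloisAction

namespace ZTowerTempered

variable {K : Type} [Field K] (X : SemiGraphs.TemperedArithmeticGroup.{0} K) (φ φ' : X.Pi →* Multiplicative ℤ)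
  (hφ : ∀ g : X.Pi, φ' g = (φ g)⁻¹) (R S : ((ConnectedPart (BTemp X.Pi))ᵒᵖ ⥤ CommMonCat.{0}) → Prop)

/-! ### The isomorphism of Def. 3.3 (iii) data `dm X φ ≅ dm X φ'` given by the chain reflection -/

/-- **The reflection `n ↦ −n` as an isomorphism of the Def. 3.3 (iii) data of the two ℤ-towers along the common base functor**
(engine record `PfIsoData`: `e := reflectPhiZero`, `b := reflectBZero`, naturality `rfl`, `div₀`-compatibility by
`divZeroHom_reflectBZero`, `Φ = im(Φ₀^pf → Φ₀^rlf)` on both sides by `rfl`). [cite: MochizukiEtTh2009, Def 3.3 p.73] -/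
def reflectIsoData :
    TemperedFrobenioid.PfIsoData (hpf X φ) (hpf X φ') (temperedFrobenioid X φ R S) (temperedFrobenioid X φ' R S) where
  e A := ZTower.reflectPhiZero φ φ' hφ (gset X A.unop)
  e_natural _ _ := rfl
  b A := ZTower.reflectBZero φ φ' hφ (gset X A.unop)
  b_natural _ _ := rfl
  div₀_b A x := by
    change (ZTower.action φ').divZeroHom (gset X A.unop) (ZTower.reflectBZero φ φ' hφ (gset X A.unop) x) =
      gpMap (ZTower.reflectPhiZero φ φ' hφ (gset X A.unop)).toMonoidHom ((ZTower.action φ).divZeroHom (gset X A.unop) x)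
    rw [ZTower.divZeroHom_reflectBZero, ZTower.divZeroHom_eq_numDen, map_div, gpMap_of, gpMap_of]
    rfl
  hΦ₁ _ := rfl
  hΦ₂ _ := rfl

/-- **`Ψ : C_φ ≌ C_{φ'}`** — the equivalence of the ℤ-tower tempered Frobenioids at `φ` and at `φ' = φ⁻¹` induced by the reflection
([FrdI] Cor. 5.4 via FILE 1). [cite: MochizukiFrdI2008, Cor. 5.4 p.104] -/
def reflectEquiv : (temperedFrobenioid X φ R S).category ≌ (temperedFrobenioid X φ' R S).category :=
  (reflectIsoData X φ φ' hφ R S).equivalence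

/-- **`Ψ` lies over the identity of `B^temp(Π^tp_X)⁰` on the nose.** [cite: MochizukiEtTh2009, Thm 4.4 p.93] -/
theorem reflectEquiv_functor_comp_base :
    (reflectEquiv X φ φ' hφ R S).functor ⋙ (temperedFrobenioid X φ' R S).baseFunctorOfCategory =
      (temperedFrobenioid X φ R S).baseFunctorOfCategory ⋙ 𝟭 _ :=
  (reflectIsoData X φ φ' hφ R S).functor_comp_baseFunctor

/-- **`Ψ` on objects: `(A, α) ↦ (A, η_A^gp α)`** with `η_A = (reflection)^rlf|_Φ`. [cite: MochizukiFrdI2008, Thm. 5.2 (i) p.100] -/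
theorem reflectEquiv_functor_obj (A : (temperedFrobenioid X φ R S).category) :
    (reflectEquiv X φ φ' hφ R S).functor.obj A =
      ⟨A.base, MonGp.map ((reflectIsoData X φ φ' hφ R S).ηHom (op A.base)) A.cls⟩ :=
  (reflectIsoData X φ φ' hφ R S).equivalence_functor_obj A

/-- **`Ψ` acts on divisors by the reflection**: `η_A (ι ψ) = ι (ψ ∘ (n ↦ −n))` for `ψ ∈ Φ₀^{φ}(Π/H)` — so `Ψ` is NOT an identity
functor as soon as `φ ≠ φ'`. [cite: MochizukiEtTh2009, Def 3.6 p.77] -/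
theorem coe_ηHom_toR (A : (ConnectedPart (BTemp X.Pi))ᵒᵖ) (ψ : (ZTower.action φ).phiZero (gset X A.unop)) :
    ((reflectIsoData X φ φ' hφ R S).ηHom A
      ⟨(hpf X φ _).weak.toRealification (Literature.AlgebraicGeometry.Frobenioids.Perfection.of _ ψ), ⟨_, rfl⟩⟩).1 =
      (hpf X φ' _).weak.toRealification (Literature.AlgebraicGeometry.Frobenioids.Perfection.of _ (ZTower.reflectPhiZero φ φ' hφ (gset X A.unop) ψ)) :=
  (reflectIsoData X φ φ' hφ R S).coe_ηHom_toRealification A (Literature.AlgebraicGeometry.Frobenioids.Perfection.of _ ψ) ⟨_, rfl⟩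

/-! ### `Thm44Hyp` between the settings at `φ` and at `φ'` -/

variable (NH : Subgroup (Field.absoluteGaloisGroup K) → (temperedFrobenioid X φ R S).category → ℕ+ → Prop)
  (NH' : Subgroup (Field.absoluteGaloisGroup K) → (temperedFrobenioid X φ' R S).category → ℕ+ → Prop)
  (M : OpenNormalSubgroup X.Pi)

/-- **`Thm44Hyp (setting X φ …) (setting X φ' …)` INHABITED with the NON-identity `Ψ := reflectEquiv`** (`Ψ^bs := 𝟭`, `comm` on the
nose, `Ψ^bs(A_⊙^bs) = A_⊙^bs`; `Φ` non-dilating on both sides by `ZTowerTempered.isNonDilating`; `baseShape` with `𝒟 := Π/Π`; `H_⊙`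
open). [cite: MochizukiEtTh2009, Thm 4.4 p.93] -/
def thm44HypReflect : BiKummerSetting.Thm44Hyp (setting X φ R S NH M) (setting X φ' R S NH' M) where
  isNonDilating₁ A α := isNonDilating X φ R S A α
  isNonDilating₂ A α := isNonDilating X φ' R S A α
  baseShape₁ := baseShape X φ R S
  baseShape₂ := baseShape X φ' R S
  isOpen_Hodot₁ := BiKummerSetting.isOpen_Hodot_mkOfConnectedTemperoid X _ _ _ NH _ _ _
  isOpen_Hodot₂ := BiKummerSetting.isOpen_Hodot_mkOfConnectedTemperoid X _ _ _ NH' _ _ _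
  Ψ := reflectEquiv X φ φ' hφ R S
  Ψbs := CategoryTheory.Equivalence.refl
  comm := eqToIso (reflectEquiv_functor_comp_base X φ φ' hφ R S).symm
  mapsAodot := ⟨Iso.refl _⟩

/-- The `Ψ` of `thm44HypReflect` IS the reflection equivalence. [cite: MochizukiEtTh2009, Thm 4.4 p.93] -/
theorem thm44HypReflect_Ψ : (thm44HypReflect X φ φ' hφ R S NH NH' M).Ψ = reflectEquiv X φ φ' hφ R S := rfl

include hφ in
/-- **Non-vacuity of `Thm44Hyp` between the two settings.** [cite: MochizukiEtTh2009, Thm 4.4 p.93] -/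
theorem nonempty_thm44HypReflect :
    Nonempty (BiKummerSetting.Thm44Hyp (setting X φ R S NH M) (setting X φ' R S NH' M)) :=
  ⟨thm44HypReflect X φ φ' hφ R S NH NH' M⟩

/-- **[EtTh] Thm. 4.4 (i) FIRES along the reflection** (this lineage's `thm44_i_mkOfConnectedTemperoid_of_baseInj_treeVocabWeak`
⇐ {`hBD X φ`, `hBD X φ'`}). [cite: MochizukiEtTh2009, Thm 4.4 (i) p.94] -/
theorem thm44_i_reflect : BiKummerSetting.Thm44_i (thm44HypReflect X φ φ' hφ R S NH NH' M) :=
  (thm44HypReflect X φ φ' hφ R S NH NH' M).thm44_i_mkOfConnectedTemperoid_of_baseInj_treeVocabWeak _ _ _ NH _ _ _ _ _ _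
    NH' _ _ _ (fun α => hBD X φ R S α) fun α => hBD X φ' R S α

/-- T44-L03 along the reflection (from `hBD`). [cite: MochizukiEtTh2009, Thm 4.4 p.95] -/
theorem preservesFrobeniusStructure_reflect : (thm44HypReflect X φ φ' hφ R S NH NH' M).PreservesFrobeniusStructure :=
  (thm44HypReflect X φ φ' hφ R S NH NH' M).preservesFrobeniusStructure_mkOfConnectedTemperoid_of_baseInj_treeVocabWeak _ _ _
    NH _ _ _ _ _ _ NH' _ _ _ (fun α => hBD X φ R S α) fun α => hBD X φ' R S α

/-- The `ψ`-slot of Thm. 4.4 (ii)(iii) along the reflection: this lineage's `psiModel`. [cite: MochizukiEtTh2009, Thm 4.4 p.94] -/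
abbrev ψReflect (A : (setting X φ R S NH M).C) :
    (setting X φ R S NH M).biratUnits A ≃*
      (setting X φ' R S NH' M).biratUnits ((thm44HypReflect X φ φ' hφ R S NH NH' M).Ψ.functor.obj A) :=
  (thm44HypReflect X φ φ' hφ R S NH NH' M).psiModel (isFrobenioid_temperedFrobenioid X φ R S)
    (isFrobenioid_temperedFrobenioid X φ' R S) (preservesFrobeniusStructure_reflect X φ φ' hφ R S NH NH' M) A

end ZTowerTempered

namespace ZTowerTempered

variable {K : Type} [Field K] (X : SemiGraphs.TemperedArithmeticGroup.{0} K) (φ φ' : X.Pi →* Multiplicative ℤ)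
  (hφ : ∀ g : X.Pi, φ' g = (φ g)⁻¹) (R S : ((ConnectedPart (BTemp X.Pi))ᵒᵖ ⥤ CommMonCat.{0}) → Prop) (M : OpenNormalSubgroup X.Pi)

/-- T44-L15b along the reflection with the trivial `(N, H)`-slots: tautological. [cite: MochizukiEtTh2009, Thm 4.4 p.95] -/
theorem preservesNHSaturatedBsFld_trivNH_reflect :
    (thm44HypReflect X φ φ' hφ R S (trivNHOf X φ R S) (trivNHOf X φ' R S) M).PreservesNHSaturatedBsFld :=
  fun _ _ _ _ _ => Iff.rfl

/-- **[EtTh] Thm. 4.4 (i) ∧ (ii) ∧ (iii)-saturation ∧ N-th roots FIRE along the reflection** (trivial `(N, H)`-slots; this lineage's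
`thm44_mkOfConnectedTemperoid_of_baseInj_treeVocabWeak'` ⇐ {`hBD X φ`, `hBD X φ'`, T44-L15b}). [cite: MochizukiEtTh2009, Thm 4.4 p.94] -/
theorem thm44_trivNH_reflect :
    BiKummerSetting.Thm44_i (thm44HypReflect X φ φ' hφ R S (trivNHOf X φ R S) (trivNHOf X φ' R S) M) ∧
      BiKummerSetting.Thm44_ii (thm44HypReflect X φ φ' hφ R S (trivNHOf X φ R S) (trivNHOf X φ' R S) M)
        (ψReflect X φ φ' hφ R S (trivNHOf X φ R S) (trivNHOf X φ' R S) M) ∧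
      BiKummerSetting.Thm44_iii (thm44HypReflect X φ φ' hφ R S (trivNHOf X φ R S) (trivNHOf X φ' R S) M)
        (ψReflect X φ φ' hφ R S (trivNHOf X φ R S) (trivNHOf X φ' R S) M) ∧
      (thm44HypReflect X φ φ' hφ R S (trivNHOf X φ R S) (trivNHOf X φ' R S) M).PreservesNthRoots
        (ψReflect X φ φ' hφ R S (trivNHOf X φ R S) (trivNHOf X φ' R S) M)
        (fun φ'' f => (temperedFrobenioid X φ R S).pullFracModel φ'' f)
        fun φ'' f => (temperedFrobenioid X φ' R S).pullFracModel φ'' f :=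
  (thm44HypReflect X φ φ' hφ R S (trivNHOf X φ R S) (trivNHOf X φ' R S) M).thm44_mkOfConnectedTemperoid_of_baseInj_treeVocabWeak'
    _ _ _ _ _ _ _ _ _ _ _ _ _ _ (fun α => hBD X φ R S α) (fun α => hBD X φ' R S α)
    (preservesNHSaturatedBsFld_trivNH_reflect X φ φ' hφ R S M)

/-- **[EtTh] Thm. 4.4 (i) ∧ (ii) ∧ (iii)-saturation ∧ N-th roots FIRE along the reflection AT THE ROOTS READING** of the
`(N, H_⊙^{bs-fld})`-slots (⇐ {`hBD X φ`, `hBD X φ'`}; T44-L15b by abc-iut-w4-d044's `preservesNHSaturatedBsFld_rootsReading`).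
[cite: MochizukiEtTh2009, Thm 4.4 p.94] -/
theorem thm44_rootsNH_reflect :
    BiKummerSetting.Thm44_i (thm44HypReflect X φ φ' hφ R S (rootsNHOf X φ R S M) (rootsNHOf X φ' R S M) M) ∧
      BiKummerSetting.Thm44_ii (thm44HypReflect X φ φ' hφ R S (rootsNHOf X φ R S M) (rootsNHOf X φ' R S M) M)
        (ψReflect X φ φ' hφ R S (rootsNHOf X φ R S M) (rootsNHOf X φ' R S M) M) ∧
      BiKummerSetting.Thm44_iii (thm44HypReflect X φ φ' hφ R S (rootsNHOf X φ R S M) (rootsNHOf X φ' R S M) M)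
        (ψReflect X φ φ' hφ R S (rootsNHOf X φ R S M) (rootsNHOf X φ' R S M) M) ∧
      (thm44HypReflect X φ φ' hφ R S (rootsNHOf X φ R S M) (rootsNHOf X φ' R S M) M).PreservesNthRoots
        (ψReflect X φ φ' hφ R S (rootsNHOf X φ R S M) (rootsNHOf X φ' R S M) M)
        (fun φ'' f => (temperedFrobenioid X φ R S).pullFracModel φ'' f)
        fun φ'' f => (temperedFrobenioid X φ' R S).pullFracModel φ'' f :=
  (thm44HypReflect X φ φ' hφ R S (rootsNHOf X φ R S M) (rootsNHOf X φ' R S M) M).thm44_mkOfConnectedTemperoid_rootsReading_of_baseInj_treeVocabWeak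
    (temperedFrobenioid X φ R S) rfl (hP X φ R S) ((temperedFrobenioid X φ R S).connQuotZeroObj M)
    ((temperedFrobenioid X φ R S).isFrobeniusTrivial_connQuotZeroObj M)
    ((temperedFrobenioid X φ R S).isGaloisObj_connQuotZeroObj_base M)
    (temperedFrobenioid X φ' R S) rfl (hP X φ' R S) ((temperedFrobenioid X φ' R S).connQuotZeroObj M)
    ((temperedFrobenioid X φ' R S).isFrobeniusTrivial_connQuotZeroObj M)
    ((temperedFrobenioid X φ' R S).isGaloisObj_connQuotZeroObj_base M)
    (isFrobenioid_temperedFrobenioid X φ R S) (isFrobenioid_temperedFrobenioid X φ' R S)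
    (preservesFrobeniusStructure_reflect X φ φ' hφ R S _ _ M) (fun α => hBD X φ R S α) fun α => hBD X φ' R S α

/-! ### Non-vacuity at `φ' := φ⁻¹` -/

/-- **For EVERY character `φ` the pair `(φ, φ⁻¹)` qualifies**: `Thm44Hyp (setting X φ …) (setting X φ⁻¹ …)` is inhabited with
`Ψ` the reflection equivalence, and Thm. 4.4 (i) fires there. [cite: MochizukiEtTh2009, Thm 4.4 p.93] -/
theorem nonempty_thm44Hyp_inv
    (NH : Subgroup (Field.absoluteGaloisGroup K) → (temperedFrobenioid X φ R S).category → ℕ+ → Prop)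
    (NH' : Subgroup (Field.absoluteGaloisGroup K) → (temperedFrobenioid X φ⁻¹ R S).category → ℕ+ → Prop) :
    ∃ h : BiKummerSetting.Thm44Hyp (setting X φ R S NH M) (setting X φ⁻¹ R S NH' M),
      h.Ψ = reflectEquiv X φ φ⁻¹ (ZTower.inv_apply_eq φ) R S ∧ BiKummerSetting.Thm44_i h :=
  ⟨thm44HypReflect X φ φ⁻¹ (ZTower.inv_apply_eq φ) R S NH NH' M, rfl,
    thm44_i_reflect X φ φ⁻¹ (ZTower.inv_apply_eq φ) R S NH NH' M⟩

end ZTowerTempered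

end Literature.AnabelianGeometry.EtaleTheta

end
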